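import Summits.BirchSwinnertonDyer.BirchSwinnertonDyer.Theorems.ResidualThetaTransportAtTwoThetaLayerLambdaCongruenceAtTwoPeriodFactor
import HarnessLib

/-!
# Crux `ThetaLayerLambdaCongruenceAtTwo` (stmt-BirchSwinnertonDyer-20688, route ResidualThetaTransportAtTwo), line
# `birth` v13 — SD floor, brick S4 (part 1): UNIVERSAL DUAL CHAINS (walks in the dual graph of the Farey tessellation)
# and their Manin systems (width seat bsd-wall-rtt-p3-w2 g8; `--supports stmt-BirchSwinnertonDyer-20688 --as helper`;
# closes nothing)

HONEST FRAMING. Elementary THEOREMS about lists of matrices and functions on the coset space `SL₂(ℤ)/Γ₀(N)`; no definition;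
nothing about any curve or form is asserted; BSD is not proved by any of this.

WHAT. The universal Manin chain of `…ManinChain` telescopes over CUSP functions (`F(gT) = F(g)`, `F(−g) = F(g)`: functions of
`g·∞`). Dually, call a list `D` of matrices a DUAL CHAIN of `k ∈ SL₂(ℤ)` if `Σ_{h∈D} (G(h) − G(hS)) = G(k) − G(1)` for every
TRIANGLE function `G` (`G(gτ) = G(g)`, `G(−g) = G(g)`, `τ = ST⁻¹`: functions of the Farey triangle `{g∞, g0, g1} = g·{∞,0,1}`):
the element `h` is the step across the Farey edge `{h∞, h0}` from the triangle of `hS` to the triangle of `h` — a walk in the dual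
tree from the base triangle to `k·{∞,0,1}`.
* §1 `exists_dualChain`: every `k ∈ SL₂(ℤ)` has a dual chain (Euclid on the first column as in `exists_maninChain`, with
  `T = τ⁻¹S`: the powers `Tʲ` contribute one crossing each).
* §2 `dualChainVec_smul_S`, `dualChainVec_three_term`, `dualChainVec_eq_zero_of_S_fixed`, `dualChainVec_eq_zero_of_TS_fixed`: for
  `γ ∈ Γ₀(N)` and a dual chain `D` of `γ`, the SIGNED CROSSING VECTOR `Σ_{h∈D} (e_{h⁻¹Γ₀(N)} − e_{(hS)⁻¹Γ₀(N)}) ∈ ℤ^X` (inline, in the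
  `Pi.single` convention of `…ManinChain.chainVec`) is an INTEGRAL MANIN SYSTEM killing the elliptic cosets — hypotheses (i)–(iv) of
  `…ManinSymbolTorsion` / `…ManinSystemFactor` over `ℤ` (the closed walk is a `1`-cycle of the dual graph mod `Γ₀(N)`; (ii) is the
  telescoping identity for the indicator of a `TS`-orbit, (i) is `(hS)⁻¹Γ₀(N) = S·h⁻¹Γ₀(N)`, (iii)/(iv) follow over `ℤ`).
Hence (`…ManinSystemFactor.exists_addMonoidHom_periodHomology_of_maninSystem`) every dual chain of every `γ ∈ Γ₀(N)` defines an additive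
`φ : Λ → ℤ` on the period lattice whose value on `{∞, γ'∞}` is the SIGNED CROSSING COUNT of the walk with the Farey chain of `γ'` —
the candidate intersection pairing of `Cruxes/…/Lines/birth-sd2-architecture.md` (brick S4; independence of `D`, additivity in `γ` and
Hecke adjointness are NOT here).

References: [Manin1972] §1.5–1.7, Thm. 1.6; J.-P. Serre, Trees, §I.4 (the tree of `SL₂(ℤ)`); [CremonaAlgorithms1997] §2.2.
-/

set_option autoImplicit false

noncomputable section

-- justification: the `Summit.BirchSwinnertonDyer.BirchSwinnertonDyer.…` path repeats a component (route-file convention)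
set_option linter.dupNamespace false

open scoped Classical MatrixGroups

open CongruenceSubgroup Matrix.SpecialLinearGroup ModularGroup
open Literature.NumberTheory.EllipticCurves.ModularForms

namespace Summit.BirchSwinnertonDyer.BirchSwinnertonDyer.Theorems.ThetaLayerLambdaCongruenceAtTwo

/-! ## §1. Universal dual chains -/

section DualChain

/-- `T S = −τ⁻¹` with `τ = S T⁻¹`, hence a triangle function satisfies `G(gTS) = G(g)`. [folklore] -/
theorem apply_mul_T_mul_S_of_triangle {A : Type} (G : SL(2, ℤ) → A) (hτ : ∀ g, G (g * (S * T⁻¹)) = G g)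
    (hneg : ∀ g, G (-g) = G g) (g : SL(2, ℤ)) : G (g * T * S) = G g := by
  have e : g * T * S = -(g * (S * T⁻¹)⁻¹) := by
    rw [mul_inv_rev, inv_inv, S_inv_eq_neg_S, mul_neg, mul_neg, neg_neg, mul_assoc]
  have h := hτ (g * (S * T⁻¹)⁻¹)
  rw [inv_mul_cancel_right] at h
  rw [e, hneg, h]

/-- `T⁻¹ = −Sτ`, hence a triangle function satisfies `G(gS) = G(gT⁻¹)`. [folklore] -/
theorem apply_mul_S_of_triangle {A : Type} (G : SL(2, ℤ) → A) (hτ : ∀ g, G (g * (S * T⁻¹)) = G g)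
    (hneg : ∀ g, G (-g) = G g) (g : SL(2, ℤ)) : G (g * S) = G (g * T⁻¹) := by
  have e : g * T⁻¹ = -(g * S * (S * T⁻¹)) := by
    rw [mul_assoc, ← mul_assoc S, S_mul_S_eq_neg_one, neg_one_mul, mul_neg]
    simp
  rw [e, hneg, hτ]

/-- Dual chain along a power of `T`: from the triangle of `g` to the triangle of `gTʲ` (one crossing per step).
[cite: Manin1972, Thm. 1.6] -/
theorem exists_dualChain_T_zpow (g : SL(2, ℤ)) (j : ℤ) :
    ∃ D : List SL(2, ℤ), ∀ {A : Type} [AddCommGroup A] (G : SL(2, ℤ) → A),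
      (∀ x, G (x * (S * T⁻¹)) = G x) → (∀ x, G (-x) = G x) →
        (D.map fun h ↦ G h - G (h * S)).sum = G (g * T ^ j) - G g := by
  induction j using Int.induction_on with
  | zero => exact ⟨[], fun G _ _ ↦ by simp⟩
  | succ n ih =>
    obtain ⟨D, hD⟩ := ih
    refine ⟨D ++ [g * T ^ ((n : ℤ) + 1)], fun G hτ hneg ↦ ?_⟩
    rw [List.map_append, List.sum_append, hD G hτ hneg, List.map_singleton, List.sum_singleton,
      show g * T ^ ((n : ℤ) + 1) * S = g * T ^ (n : ℤ) * T * S by rw [zpow_add_one, ← mul_assoc],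
      apply_mul_T_mul_S_of_triangle G hτ hneg]
    abel
  | pred n ih =>
    obtain ⟨D, hD⟩ := ih
    refine ⟨D ++ [g * T ^ (-(n : ℤ)) * S], fun G hτ hneg ↦ ?_⟩
    rw [List.map_append, List.sum_append, hD G hτ hneg, List.map_singleton, List.sum_singleton,
      mul_assoc (g * T ^ (-(n : ℤ))), S_mul_S_eq_neg_one, mul_neg_one, hneg,
      apply_mul_S_of_triangle G hτ hneg, mul_assoc g, ← zpow_sub_one]
    abel

/-- **The universal dual chain of `k`.** There is a list `D` of matrices with `Σ_{h ∈ D} (G h − G (hS)) = G k − G 1` for every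
`G : SL₂(ℤ) → A` (any additive group `A`) with `G(gτ) = G(g)` (`τ = ST⁻¹`) and `G(−g) = G(g)` — a walk in the dual tree of the Farey
tessellation from the triangle `{∞, 0, 1}` to `k·{∞, 0, 1}`, each `h` being the crossing of the edge `{h∞, h0}` from the triangle of
`hS` into the triangle of `h`. (Euclid on the first column as in `exists_maninChain`: `k' = kTᵐS`, then `k = −k'STᵐ⁻`.)
[cite: Manin1972, Thm. 1.6] -/
theorem exists_dualChain (k : SL(2, ℤ)) :
    ∃ D : List SL(2, ℤ), ∀ {A : Type} [AddCommGroup A] (G : SL(2, ℤ) → A),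
      (∀ x, G (x * (S * T⁻¹)) = G x) → (∀ x, G (-x) = G x) → (D.map fun h ↦ G h - G (h * S)).sum = G k - G 1 := by
  suffices H : ∀ n : ℕ, ∀ k : SL(2, ℤ), (k 1 0).natAbs = n →
      ∃ D : List SL(2, ℤ), ∀ {A : Type} [AddCommGroup A] (G : SL(2, ℤ) → A),
        (∀ x, G (x * (S * T⁻¹)) = G x) → (∀ x, G (-x) = G x) → (D.map fun h ↦ G h - G (h * S)).sum = G k - G 1 from
    H _ k rfl
  intro n
  induction n using Nat.strong_induction_on with
  | _ n ih =>
    intro k hk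
    by_cases hz : k 1 0 = 0
    · -- `k = ± T^j`
      have hdet := Matrix.SpecialLinearGroup.det_coe k
      rw [Matrix.det_fin_two, hz, mul_zero, sub_zero] at hdet
      obtain ⟨D, hD⟩ := exists_dualChain_T_zpow 1 (k 0 0 * k 0 1)
      refine ⟨D, fun G hτ hneg ↦ ?_⟩
      rw [hD G hτ hneg, one_mul]
      rcases Int.eq_one_or_neg_one_of_mul_eq_one hdet with h00 | h00
      · have h11 : k 1 1 = 1 := by rw [h00, one_mul] at hdet; exact hdet
        have hkT : k = T ^ (k 0 0 * k 0 1) := by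
          ext i j
          fin_cases i <;> fin_cases j <;> simp [coe_T_zpow, h00, h11, hz]
        rw [← hkT]
      · have h11 : k 1 1 = -1 := by
          rw [h00] at hdet; linarith
        have hkT : k = -T ^ (k 0 0 * k 0 1) := by
          ext i j
          fin_cases i <;> fin_cases j <;> simp [coe_T_zpow, h00, h11, hz]
        conv_rhs => rw [hkT, hneg]
    · -- Euclidean step: `k' = k Tᵐ S` has smaller lower-left entry, and `k = -(k' S T^{-m})`
      set m : ℤ := -(k 1 1 / k 1 0) with hm
      set k' : SL(2, ℤ) := k * T ^ m * S with hk'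
      have hk'10 : k' 1 0 = k 1 1 % k 1 0 := by
        simp only [hk', coe_mul, coe_S, coe_T_zpow, Matrix.mul_apply, Fin.sum_univ_two]
        simp [hm, Int.emod_def]
        ring
      have hlt : (k' 1 0).natAbs < n := by
        rw [← hk, hk'10]
        have h0 := Int.emod_nonneg (k 1 1) hz
        have h1 := Int.emod_lt_abs (k 1 1) hz
        zify
        rw [abs_of_nonneg h0]
        exact h1
      obtain ⟨D', hD'⟩ := ih _ hlt k' rfl
      obtain ⟨D'', hD''⟩ := exists_dualChain_T_zpow (k' * S) (-m)
      refine ⟨D' ++ [k' * S] ++ D'', fun G hτ hneg ↦ ?_⟩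
      have hk : k = -(k' * S * T ^ (-m)) := by
        rw [hk', mul_assoc (k * T ^ m) S S, S_mul_S_eq_neg_one, mul_neg_one, neg_mul, mul_assoc k, ← zpow_add,
          add_neg_cancel, zpow_zero, mul_one, neg_neg]
      rw [List.map_append, List.map_append, List.sum_append, List.sum_append, hD' G hτ hneg, hD'' G hτ hneg,
        List.map_singleton, List.sum_singleton, mul_assoc k' S S, S_mul_S_eq_neg_one, mul_neg_one, hneg, hk, hneg]
      abel

end DualChain

/-! ## §2. The signed crossing vector of a closed dual chain is an integral Manin system -/

section CrossingVector

variable {N : ℕ}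

/-- `(hS)⁻¹Γ₀(N) = S·(h⁻¹Γ₀(N))` on `SL₂(ℤ)/Γ₀(N)` (`S⁻¹ = −S` and `−1` acts trivially). [folklore] -/
theorem coe_mul_S_inv (h : SL(2, ℤ)) :
    (((h * S)⁻¹ : SL(2, ℤ)) : Gamma0Coset N) = S • ((h⁻¹ : SL(2, ℤ)) : Gamma0Coset N) := by
  rw [mul_inv_rev, S_inv_eq_neg_S, ← neg_smul_coset N S, MulAction.Quotient.smul_mk, smul_eq_mul]

/-- Value of the signed crossing vector at a coset: `Σ_{h∈D} ([h⁻¹Γ₀(N) = q] − [(hS)⁻¹Γ₀(N) = q])`. [folklore] -/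
theorem dualChainVec_apply (D : List SL(2, ℤ)) (q : Gamma0Coset N) :
    (D.map fun h ↦ (Pi.single ((h⁻¹ : SL(2, ℤ)) : Gamma0Coset N) (1 : ℤ) -
      Pi.single (((h * S)⁻¹ : SL(2, ℤ)) : Gamma0Coset N) 1 : Gamma0Coset N → ℤ)).sum q =
      (D.map fun h ↦ (if ((h⁻¹ : SL(2, ℤ)) : Gamma0Coset N) = q then (1 : ℤ) else 0) -
        (if (((h * S)⁻¹ : SL(2, ℤ)) : Gamma0Coset N) = q then (1 : ℤ) else 0)).sum := by
  induction D with
  | nil => simp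
  | cons h D ih =>
    simp only [List.map_cons, List.sum_cons, Pi.add_apply, Pi.sub_apply, ih]
    congr 1
    rw [Pi.single_apply, Pi.single_apply]
    exact congrArg₂ (· - ·) (if_congr eq_comm rfl rfl) (if_congr eq_comm rfl rfl)

/-- **(i) Antisymmetry under `S`** of the signed crossing vector of ANY list: `v(S·q) = −v(q)`. [folklore] -/
theorem dualChainVec_smul_S (D : List SL(2, ℤ)) (q : Gamma0Coset N) :
    (D.map fun h ↦ (Pi.single ((h⁻¹ : SL(2, ℤ)) : Gamma0Coset N) (1 : ℤ) -
      Pi.single (((h * S)⁻¹ : SL(2, ℤ)) : Gamma0Coset N) 1 : Gamma0Coset N → ℤ)).sum (S • q) =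
    -(D.map fun h ↦ (Pi.single ((h⁻¹ : SL(2, ℤ)) : Gamma0Coset N) (1 : ℤ) -
      Pi.single (((h * S)⁻¹ : SL(2, ℤ)) : Gamma0Coset N) 1 : Gamma0Coset N → ℤ)).sum q := by
  rw [dualChainVec_apply, dualChainVec_apply, List.sum_neg, List.map_map]
  congr 1
  refine List.map_congr_left fun h _ ↦ ?_
  have hSS : ∀ q : Gamma0Coset N, S • S • q = q := fun q ↦ by
    rw [← mul_smul, S_mul_S_eq_neg_one, neg_one_smul_coset]
  have e1 : (((h⁻¹ : SL(2, ℤ)) : Gamma0Coset N) = S • q) ↔ ((((h * S)⁻¹ : SL(2, ℤ)) : Gamma0Coset N) = q) := by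
    rw [coe_mul_S_inv]
    constructor
    · intro e; rw [e, hSS]
    · intro e; rw [← e, hSS]
  have e2 : ((((h * S)⁻¹ : SL(2, ℤ)) : Gamma0Coset N) = S • q) ↔ (((h⁻¹ : SL(2, ℤ)) : Gamma0Coset N) = q) := by
    rw [coe_mul_S_inv]
    constructor
    · intro e
      have e' := congrArg (S • ·) e
      simp only [hSS] at e'
      exact e'
    · intro e; rw [e]
  simp only [Function.comp_apply, e1, e2, neg_sub]

/-- **(ii) The three-term relation** for the signed crossing vector of a dual chain of `γ ∈ Γ₀(N)` (a CLOSED walk mod `Γ₀(N)`):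
`v(q) + v(TS·q) + v((TS)²·q) = 0` — the telescoping identity for the (τ-invariant) indicator of the `TS`-orbit of `q`: the walk
enters each triangle class as often as it leaves it. [cite: Manin1972, Thm. 1.6] -/
theorem dualChainVec_three_term (γ : Gamma0 N) (D : List SL(2, ℤ))
    (hD : ∀ {A : Type} [AddCommGroup A] (G : SL(2, ℤ) → A),
      (∀ x, G (x * (S * T⁻¹)) = G x) → (∀ x, G (-x) = G x) →
        (D.map fun h ↦ G h - G (h * S)).sum = G (γ : SL(2, ℤ)) - G 1)
    (q : Gamma0Coset N) :
    (D.map fun h ↦ (Pi.single ((h⁻¹ : SL(2, ℤ)) : Gamma0Coset N) (1 : ℤ) -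
      Pi.single (((h * S)⁻¹ : SL(2, ℤ)) : Gamma0Coset N) 1 : Gamma0Coset N → ℤ)).sum q +
    (D.map fun h ↦ (Pi.single ((h⁻¹ : SL(2, ℤ)) : Gamma0Coset N) (1 : ℤ) -
      Pi.single (((h * S)⁻¹ : SL(2, ℤ)) : Gamma0Coset N) 1 : Gamma0Coset N → ℤ)).sum ((T * S) • q) +
    (D.map fun h ↦ (Pi.single ((h⁻¹ : SL(2, ℤ)) : Gamma0Coset N) (1 : ℤ) -
      Pi.single (((h * S)⁻¹ : SL(2, ℤ)) : Gamma0Coset N) 1 : Gamma0Coset N → ℤ)).sum ((T * S) • (T * S) • q) = 0 := by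
  have hTS3 : ∀ q : Gamma0Coset N, (T * S) • (T * S) • (T * S) • q = q := fun q ↦ by
    rw [← mul_smul, ← mul_smul, TS_pow_three_eq, neg_one_smul_coset]
  -- the indicator of the `TS`-orbit of `q`, read on `SL₂(ℤ)` through `h ↦ h⁻¹Γ₀(N)`
  let G : SL(2, ℤ) → ℤ := fun h ↦
    (if ((h⁻¹ : SL(2, ℤ)) : Gamma0Coset N) = q then 1 else 0) +
    (if ((h⁻¹ : SL(2, ℤ)) : Gamma0Coset N) = (T * S) • q then 1 else 0) +
    (if ((h⁻¹ : SL(2, ℤ)) : Gamma0Coset N) = (T * S) • (T * S) • q then 1 else 0)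
  have hGdef : ∀ h, G h = (if ((h⁻¹ : SL(2, ℤ)) : Gamma0Coset N) = q then 1 else 0) +
    (if ((h⁻¹ : SL(2, ℤ)) : Gamma0Coset N) = (T * S) • q then 1 else 0) +
    (if ((h⁻¹ : SL(2, ℤ)) : Gamma0Coset N) = (T * S) • (T * S) • q then 1 else 0) := fun h ↦ rfl
  -- `τ`-invariance: `(xτ)⁻¹Γ₀(N) = (TS)·x⁻¹Γ₀(N)` permutes the three conditions
  have hτinv : ∀ x : SL(2, ℤ), (((x * (S * T⁻¹))⁻¹ : SL(2, ℤ)) : Gamma0Coset N) = (T * S) • ((x⁻¹ : SL(2, ℤ)) : Gamma0Coset N) :=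
    fun x ↦ by
      rw [mul_inv_rev, mul_inv_rev, inv_inv, S_inv_eq_neg_S, mul_neg, ← neg_smul_coset N (T * S),
        MulAction.Quotient.smul_mk, smul_eq_mul]
  have hG : ∀ x, G (x * (S * T⁻¹)) = G x := fun x ↦ by
    rw [hGdef, hGdef, hτinv]
    have c1 : ((T * S) • ((x⁻¹ : SL(2, ℤ)) : Gamma0Coset N) = q) ↔
        (((x⁻¹ : SL(2, ℤ)) : Gamma0Coset N) = (T * S) • (T * S) • q) := by
      constructor
      · intro e; rw [← e, hTS3]
      · intro e; rw [e, hTS3]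
    have c2 : ((T * S) • ((x⁻¹ : SL(2, ℤ)) : Gamma0Coset N) = (T * S) • q) ↔ (((x⁻¹ : SL(2, ℤ)) : Gamma0Coset N) = q) := by
      constructor
      · intro e
        have e' := congrArg (fun r ↦ (T * S) • (T * S) • r) e
        simp only [hTS3] at e'
        exact e'
      · intro e; rw [e]
    have c3 : ((T * S) • ((x⁻¹ : SL(2, ℤ)) : Gamma0Coset N) = (T * S) • (T * S) • q) ↔
        (((x⁻¹ : SL(2, ℤ)) : Gamma0Coset N) = (T * S) • q) := by
      constructor
      · intro e
        have e' := congrArg (fun r ↦ (T * S) • (T * S) • r) e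
        simp only [hTS3] at e'
        exact e'
      · intro e; rw [e]
    simp only [c1, c2, c3]
    abel
  have hGneg : ∀ x, G (-x) = G x := fun x ↦ by
    have e : ((((-x)⁻¹ : SL(2, ℤ))) : Gamma0Coset N) = ((x⁻¹ : SL(2, ℤ)) : Gamma0Coset N) := by
      rw [QuotientGroup.eq, inv_inv, neg_mul, mul_inv_cancel]
      simp [Gamma0_mem]
    rw [hGdef, hGdef, e]
  have tele := hD G hG hGneg
  have hγ1 : G (γ : SL(2, ℤ)) = G 1 := by
    rw [hGdef, hGdef]
    have : (((γ : SL(2, ℤ))⁻¹ : SL(2, ℤ)) : Gamma0Coset N) = (((1 : SL(2, ℤ))⁻¹ : SL(2, ℤ)) : Gamma0Coset N) := by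
      rw [inv_one, QuotientGroup.eq]
      simp
    rw [this]
  rw [hγ1, sub_self] at tele
  -- unfold the three values and regroup the telescoping sum
  have key : (D.map fun h ↦ (if ((h⁻¹ : SL(2, ℤ)) : Gamma0Coset N) = q then (1 : ℤ) else 0) -
        (if (((h * S)⁻¹ : SL(2, ℤ)) : Gamma0Coset N) = q then (1 : ℤ) else 0)).sum +
      (D.map fun h ↦ (if ((h⁻¹ : SL(2, ℤ)) : Gamma0Coset N) = (T * S) • q then (1 : ℤ) else 0) -
        (if (((h * S)⁻¹ : SL(2, ℤ)) : Gamma0Coset N) = (T * S) • q then (1 : ℤ) else 0)).sum +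
      (D.map fun h ↦ (if ((h⁻¹ : SL(2, ℤ)) : Gamma0Coset N) = (T * S) • (T * S) • q then (1 : ℤ) else 0) -
        (if (((h * S)⁻¹ : SL(2, ℤ)) : Gamma0Coset N) = (T * S) • (T * S) • q then (1 : ℤ) else 0)).sum =
      (D.map fun h ↦ G h - G (h * S)).sum := by
    rw [← List.sum_map_add, ← List.sum_map_add]
    congr 1
    refine List.map_congr_left fun h _ ↦ ?_
    simp only [hGdef]
    abel
  rw [dualChainVec_apply, dualChainVec_apply, dualChainVec_apply, key, tele]

/-- **(iii)** over `ℤ`, (i) forces the crossing vector to vanish on the `S`-fixed cosets. [folklore] -/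
theorem dualChainVec_eq_zero_of_S_fixed (D : List SL(2, ℤ)) (q : Gamma0Coset N) (hq : S • q = q) :
    (D.map fun h ↦ (Pi.single ((h⁻¹ : SL(2, ℤ)) : Gamma0Coset N) (1 : ℤ) -
      Pi.single (((h * S)⁻¹ : SL(2, ℤ)) : Gamma0Coset N) 1 : Gamma0Coset N → ℤ)).sum q = 0 := by
  have h := dualChainVec_smul_S D q
  rw [hq] at h
  omega

/-- **(iv)** over `ℤ`, (ii) forces the crossing vector of a dual chain of `γ ∈ Γ₀(N)` to vanish on the `TS`-fixed cosets. [folklore] -/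
theorem dualChainVec_eq_zero_of_TS_fixed (γ : Gamma0 N) (D : List SL(2, ℤ))
    (hD : ∀ {A : Type} [AddCommGroup A] (G : SL(2, ℤ) → A),
      (∀ x, G (x * (S * T⁻¹)) = G x) → (∀ x, G (-x) = G x) →
        (D.map fun h ↦ G h - G (h * S)).sum = G (γ : SL(2, ℤ)) - G 1)
    (q : Gamma0Coset N) (hq : (T * S) • q = q) :
    (D.map fun h ↦ (Pi.single ((h⁻¹ : SL(2, ℤ)) : Gamma0Coset N) (1 : ℤ) -
      Pi.single (((h * S)⁻¹ : SL(2, ℤ)) : Gamma0Coset N) 1 : Gamma0Coset N → ℤ)).sum q = 0 := by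
  have h := dualChainVec_three_term γ D hD q
  rw [hq, hq] at h
  omega

end CrossingVector

end Summit.BirchSwinnertonDyer.BirchSwinnertonDyer.Theorems.ThetaLayerLambdaCongruenceAtTwo

end
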